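import Summits.ValiantsHypothesis.ValiantsHypothesis.Theses.DecompCycle1C
import Summits.ValiantsHypothesis.ValiantsHypothesis.Theorems.DepthWindowConstDepth
import Literature.Computability.AlgebraicComplexity.AndrewsForbes2022BorderLST
import Literature.Computability.AlgebraicComplexity.AndrewsForbes2022Thm38Proofs
import Literature.Computability.AlgebraicComplexity.AndrewsForbes2022Thm68Proofs
import Literature.Computability.AlgebraicComplexity.DDS21BloatedRatioDeborder
import Literature.Computability.AlgebraicComplexity.DepthThreeChasmGKKSProofs
import Literature.Computability.AlgebraicComplexity.IMMWeaklySkew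
import Literature.Computability.AlgebraicComplexity.BLMW11VPwsBarSubsetVPBar
import HarnessLib

/-!
# DecompCycle1C — the S-case of rung R2: `per` is NOT in the ε-border of constant-top-fan-in depth 3

Closes the ASIDE item `PerNotInBorderConstFaninEps` (stmt-ValiantsHypothesis-23622, banked context of
route-ValiantsHypothesis-DecompCycle1C: "for every constant `k₀`, `(per_n)` is NOT in the ε-closure of
`Σ^[k₀]ΠΣ` with p-bounded `d`"; its docstring records that in print this is only known for `det`,
Dutta–Saxena 2022 Thm 2) as a COROLLARY of a border lower bound one product-depth level up:

* `perPoly_not_mem_borderClass_constDepth` — **for every constant product-depth `Δ₀`, the permanent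
  family `(per_n)` is not in the border `borderClass ℂ (productDepthEdgeClass ℂ((ε)) _ (s n) Δ₀)` of
  p-bounded-wire-size product-depth-`Δ₀` circuits** (the approximative analogue of the lens-4 rung
  `DepthWindow.perHardConstDepth`, which is the `ε = 0` case).  Proof: the entry `(IMM_{m,d})₀₀` with
  `d = min m ⌊ε log m⌋` is a `VP` family (an explicit weakly-skew circuit, `IMMSkew`), hence `VNP`, hence a
  p-projection of `per` (VNP-completeness of `per` over `ℂ`, `isVNPComplete_perPoly_holds`); border
  membership in `productDepthEdgeClass` is stable under variable/constant projections
  (`mem_borderClass_aeval_substVCFun`) and renamings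
  (`rename_mem_borderClass_productDepthEdgeClass`, Andrews–Forbes Thm 6.8 proofs file); so a border
  constant-depth upper bound for `per` would give one for `(IMM_{m,d})₀₀`, contradicting the border
  Limaye–Srinivasan–Tavenas bound of Andrews–Forbes 2022, Cor. 6.5 (`AndrewsForbes2022_cor_6_5_engine`,
  rank methods are oblivious to `O(ε)` terms) in the super-polynomial window (`DepthWindow.window_arith`).
* `mem_borderClass_of_mem_border_spsClass` — the change of currency: the Dutta–Dwivedi–Saxena ε-border
  (`DDS2021.border`, approximants over `ℂ(ε)` with coefficients in `ℂ[ε]`, `isEpsApprox_iff_exists_map`)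
  of `Σ^[k]Π^[d]Σ` lies in the Andrews–Forbes border (`borderClass`, `ℂ((ε))`-circuits `+ O(ε)`) of
  product-depth-1 circuits with `k (d (N+2) + 1)` wires (`DepthThreeChasm.IsSPS.exists_circuit`).
* `perNotInBorderConstFaninEps_holds : PerNotInBorderConstFaninEps` — the item, from the two.

Record-only context for the route (kind aside, bc6): rung R2 (23713, `VP_ws` upper bound for the class)
is closed by `DecompCycle1CBorderConstFaninR2`; this file settles its S-case in the tree.  It is a
statement about constant depth / constant top fan-in only and says nothing about `VP ≠ VNP` itself, nor
about the general-depth-3 rungs R3lo/R3/R3hi (open in print).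
-/

set_option linter.dupNamespace false

noncomputable section

namespace Summit.ValiantsHypothesis.ValiantsHypothesis.Theorems.DecompCycle1CPerBorderConstDepth

open MvPolynomial Polynomial
open scoped RatFunc
open Literature.Computability.AlgebraicComplexity ArithCircuit
open Summit.ValiantsHypothesis.ValiantsHypothesis.Theses.DecompCycle1C
open Summit.ValiantsHypothesis.ValiantsHypothesis.Theorems.DepthWindow

/-! ### Border membership in `productDepthEdgeClass` is stable under projection -/

/-- Substituting variables by variables or constants of `F` in `f = h + O(ε)` substitutes them in the
border circuit (`ArithCircuit.substVC`): same wires, same product-depth, and `O(ε)` terms stay `O(ε)`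
(Andrews–Forbes Lemma 6.2: projections commute with setting `ε = 0`).
[cite: AndrewsForbes2022, §6.1 (Lemma 6.2, Cor. 6.5)] -/
theorem mem_borderClass_aeval_substVCFun {F : Type} [Field F] {σ τ : Type} (s : σ → τ ⊕ F)
    {f : MvPolynomial σ F} {S Δ : ℕ}
    (hf : f ∈ borderClass F (productDepthEdgeClass (LaurentSeries F) σ S Δ)) :
    aeval (substVCFun s) f ∈ borderClass F (productDepthEdgeClass (LaurentSeries F) τ S Δ) := by
  obtain ⟨h, ⟨P, hPh, hPΔ, hPs⟩, hord⟩ := hf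
  obtain ⟨t, ht⟩ : ∃ t : σ → τ ⊕ LaurentSeries F,
      t = fun v => (s v).map id (algebraMap F (LaurentSeries F)) := ⟨_, rfl⟩
  have hsub : ∀ v, substVCFun t v =
      MvPolynomial.map (algebraMap F (LaurentSeries F)) (substVCFun s v) := by
    intro v
    simp only [substVCFun, ht]
    cases s v with
    | inl y => simp
    | inr c => simp
  refine ⟨aeval (substVCFun t) h, ⟨P.substVC t, ?_, ?_, ?_⟩, ?_⟩
  · unfold Computes at hPh ⊢
    rw [eval_substVC, hPh]
  · rw [productDepth_substVC]; exact hPΔ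
  · rw [edgeSize_substVC]; exact hPs
  · have hfun : (fun v => MvPolynomial.map (algebraMap F (LaurentSeries F)) (substVCFun s v)) =
        substVCFun t := funext fun v => (hsub v).symm
    rw [MvPolynomial.aeval_eq_bind₁, MvPolynomial.aeval_eq_bind₁, map_bind₁, hfun, ← map_sub]
    exact hord.bind₁ fun v => by rw [hsub]; exact PolyOrdGE.map_algebraMap _

/-! ### Change of currency: the DDS ε-border of `Σ^[k]Π^[d]Σ` inside the Andrews–Forbes border -/

/-- **`DDS2021.border (Σ^[k]Π^[d]Σ over F(ε)) ⊆ borderClass F (product-depth 1, k (d (N+2)+1) wires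
over F((ε)))`.**  An ε-approximant `g ∈ F(ε)[x]` of `f` has coefficients in `F[ε]` with `g(ε=0) = f`
(`DDS2021.isEpsApprox_iff_exists_map`), so read in `F((ε))` it is `f + O(ε)`
(`Theorem38.polyOrdGE_one_map_polynomial_sub`); a `Σ^[k]Π^[d]Σ` expression is computed by a
product-depth-1 circuit with `k (d (N+2) + 1)` wires (`DepthThreeChasm.IsSPS.exists_circuit`).
[cite: DuttaDwivediSaxena2022, Def. 2.1; AndrewsForbes2022, §6.1] -/
theorem mem_borderClass_of_mem_border_spsClass {F : Type} [Field F] {N k d : ℕ}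
    {f : MvPolynomial (Fin N) F}
    (hf : f ∈ DDS2021.border (DDS2021.spsClass (RatFunc F) N k d)) :
    f ∈ borderClass F
      (productDepthEdgeClass (LaurentSeries F) (Fin N) (k * (d * (N + 2) + 1)) 1) := by
  obtain ⟨g, hg, hfg⟩ := hf
  obtain ⟨G, hGg, hGf⟩ := DDS2021.isEpsApprox_iff_exists_map.mp hfg
  have hsps : MS2021.IsSPS k d
      (MvPolynomial.map (algebraMap (RatFunc F) (LaurentSeries F)) g) :=
    DDS2021.isSPS_map (algebraMap (RatFunc F) (LaurentSeries F)) hg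
  -- as a `ΣΠΣ` expression with `N` variable slots per affine form
  have hsps' : DepthThreeChasm.IsSPS k d N
      (MvPolynomial.map (algebraMap (RatFunc F) (LaurentSeries F)) g) := by
    obtain ⟨α, hα⟩ := hsps
    refine ⟨fun _ => 1, fun i j => ⟨fun m => α i j (some m), id, α i j none⟩, ?_⟩
    rw [hα]
    refine Finset.sum_congr rfl fun i _ => ?_
    rw [one_smul]
    refine Finset.prod_congr rfl fun j _ => ?_
    simp only [DepthThreeChasm.AffForm.val, id, MvPolynomial.smul_eq_C_mul]
    rw [add_comm]
  obtain ⟨P, hP, hPd, hPe⟩ := hsps'.exists_circuit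
  refine ⟨MvPolynomial.map (algebraMap (RatFunc F) (LaurentSeries F)) g, ⟨P, hP, hPd, hPe.le⟩, ?_⟩
  have hmodel : MvPolynomial.map (algebraMap (RatFunc F) (LaurentSeries F)) g =
      MvPolynomial.map (algebraMap F[X] (LaurentSeries F)) G := by
    rw [← hGg, MvPolynomial.map_map, ← IsScalarTower.algebraMap_eq]
  rw [hmodel, ← hGf]
  exact Theorem38.polyOrdGE_one_map_polynomial_sub G

/-! ### The border constant-depth lower bound for the permanent -/

/-- **`per` is hard for BORDER constant-product-depth circuits over `ℂ`**: for every constant `Δ₀` there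
is no p-bounded `s` with `per_n ∈ borderClass ℂ (productDepthEdgeClass ℂ((ε)) (Fin n × Fin n) (s n) Δ₀)`
for all `n` — the `O(ε)`-robust version of `DepthWindow.perHardConstDepth`, by the border
Limaye–Srinivasan–Tavenas bound (Andrews–Forbes 2022, Cor. 6.5) transported along the p-projection
`(IMM_{m, min m ⌊ε log m⌋})₀₀ ≤ₚ per` (VNP-completeness of `per`).
[cite: AndrewsForbes2022, Cor. 6.5; Burgisser2000, Thm. 2.10] -/
theorem perPoly_not_mem_borderClass_constDepth (Δ₀ : ℕ) :
    ¬ ∃ s : ℕ → ℕ, IsPBounded s ∧ ∀ n : ℕ, perPoly (Fin n) ℂ ∈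
      borderClass ℂ (productDepthEdgeClass (LaurentSeries ℂ) (Fin n × Fin n) (s n) Δ₀) := by
  classical
  -- w.l.o.g. `Δ ≥ 1`
  suffices hmain : ∀ Δ : ℕ, 1 ≤ Δ → ¬ ∃ s : ℕ → ℕ, IsPBounded s ∧ ∀ n : ℕ, perPoly (Fin n) ℂ ∈
      borderClass ℂ (productDepthEdgeClass (LaurentSeries ℂ) (Fin n × Fin n) (s n) Δ) by
    rcases Nat.eq_zero_or_pos Δ₀ with h0 | hpos
    · subst h0
      rintro ⟨s, hs, hmem⟩
      exact hmain 1 le_rfl ⟨s, hs, fun n =>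
        borderClass_mono (productDepthEdgeClass_mono₂ _ _ le_rfl zero_le_one) (hmem n)⟩
    · exact hmain Δ₀ hpos
  intro Δ hΔ
  rintro ⟨s, hs, hmem⟩
  obtain ⟨δ, hδ, ε, hε, d₀, hd₀, hL⟩ := AndrewsForbes2022_cor_6_5_engine hΔ
  -- the degree window and the `(IMM_{m+1,d})₀₀` family
  let dd : ℕ → ℕ := fun N => min N ⌊ε * Real.log N⌋₊
  have hdd_le : ∀ N, dd N ≤ N := fun N => min_le_left _ _
  have hdd_log : ∀ N, (dd N : ℝ) ≤ ε * Real.log N := by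
    intro N
    have hlog : 0 ≤ ε * Real.log N := mul_nonneg hε.le (Real.log_natCast_nonneg N)
    exact (Nat.cast_le.2 (min_le_right _ _)).trans (Nat.floor_le hlog)
  let G : ∀ m : ℕ, MvPolynomial (Fin (dd (m + 1)) × Fin (m + 1) × Fin (m + 1)) ℂ :=
    fun m => immMatrix (Fin (m + 1)) (dd (m + 1)) ℂ 0 0
  let v : ℕ → ℕ := fun m => Fintype.card (Fin (dd (m + 1)) × Fin (m + 1) × Fin (m + 1))
  let e : ∀ m, (Fin (dd (m + 1)) × Fin (m + 1) × Fin (m + 1)) ≃ Fin (v m) :=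
    fun m => Fintype.equivFin _
  let G' : ∀ m, MvPolynomial (Fin (v m)) ℂ := fun m => renameEquiv ℂ (e m) (G m)
  -- `G` is a `VP` family
  have hG : IsVPFamily G := by
    refine ⟨⟨?_, ?_⟩, ?_⟩
    · -- number of variables `d (m+1)² ≤ (m+1)³`
      have hB : IsPBounded fun m : ℕ => (m + 1) ^ 3 :=
        IsPBounded.pow_holds (IsPBounded.add_holds IsPBounded.id (IsPBounded.const 1)) 3
      refine hB.mono fun m => ?_
      show Fintype.card (Fin (dd (m + 1)) × Fin (m + 1) × Fin (m + 1)) ≤ (m + 1) ^ 3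
      simp only [Fintype.card_prod, Fintype.card_fin]
      calc dd (m + 1) * ((m + 1) * (m + 1)) ≤ (m + 1) * ((m + 1) * (m + 1)) :=
            Nat.mul_le_mul_right _ (hdd_le _)
        _ = (m + 1) ^ 3 := by ring
    · -- degree `≤ d ≤ m+1`
      have hB : IsPBounded fun m : ℕ => m + 1 := IsPBounded.add_holds IsPBounded.id (IsPBounded.const 1)
      refine hB.mono fun m => ?_
      show (G m).totalDegree ≤ m + 1
      have hhom := isHomogeneous_immMatrix_list_prod (n := Fin (m + 1)) (k := ℂ) (dd (m + 1))
        (List.finRange (dd (m + 1))) (0 : Fin (m + 1)) 0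
      rw [List.length_finRange] at hhom
      exact hhom.totalDegree_le.trans (hdd_le _)
    · -- complexity `≤ L_ws((IMM_{m+1,d})₀₀) ≤ (d+2)(2(d+1)(m+1)+3)²`, `d ≤ m+1`
      have hid : IsPBounded fun m : ℕ => m + 1 := IsPBounded.add_holds IsPBounded.id (IsPBounded.const 1)
      have hB : IsPBounded fun m : ℕ =>
          (m + 1 + 2) * (2 * ((m + 1 + 1) * (m + 1)) + 3) ^ 2 :=
        IsPBounded.mul_holds (IsPBounded.add_holds hid (IsPBounded.const 2))
          (IsPBounded.pow_holds (IsPBounded.add_holds (IsPBounded.mul_holds (IsPBounded.const 2)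
            (IsPBounded.mul_holds (IsPBounded.add_holds hid (IsPBounded.const 1)) hid))
            (IsPBounded.const 3)) 2)
      refine hB.mono fun m => ?_
      show complexity (G m) ≤ _
      refine (complexity_le_wsComplexity _).trans
        ((IMMSkew.wsComplexity_immMatrix_entry_le ℂ (m + 1) (dd (m + 1)) 0 0).trans ?_)
      have h := hdd_le (m + 1)
      exact Nat.mul_le_mul (by omega) (Nat.pow_le_pow_left (by nlinarith) 2)
  have hG' : IsVPFamily G' := (isVPFamily_renameEquiv_iff e G).2 hG
  have hG'N : IsVNPFamily G' := IsVPFamily.isVNPFamily_holds' hG'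
  -- VNP-completeness of `per` over `ℂ`: `G' m` is a projection of `per_{t m}`, `t` p-bounded
  obtain ⟨t, ht, hproj⟩ := (isVNPComplete_perPoly_holds ℂ ringChar_complex_ne_two).2 v G' hG'N
  obtain ⟨b, hb⟩ : IsPBounded fun m => s (t m) := IsPBounded.comp_holds hs ht
  -- transport the hypothetical border upper bound of `per` to `(IMM_{m+1,d})₀₀`
  have key : ∀ m, G m ∈ borderClass ℂ (productDepthEdgeClass (LaurentSeries ℂ)
      (Fin (dd (m + 1)) × Fin (m + 1) × Fin (m + 1)) (s (t m)) Δ) := by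
    intro m
    obtain ⟨σs, hσs⟩ := exists_substVCFun_of_isProjection (hproj m)
    have h1 : G' m ∈ borderClass ℂ
        (productDepthEdgeClass (LaurentSeries ℂ) (Fin (v m)) (s (t m)) Δ) := by
      rw [hσs]; exact mem_borderClass_aeval_substVCFun σs (hmem (t m))
    have hGm : rename (e m).symm (G' m) = G m := by
      show rename (e m).symm (renameEquiv ℂ (e m) (G m)) = G m
      rw [renameEquiv_apply, rename_rename, (e m).symm_comp_self, rename_id_apply]
    rw [← hGm]
    exact rename_mem_borderClass_productDepthEdgeClass h1 (e m).symm
  -- the window where `(m+1)^{d^δ}` beats every polynomial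
  obtain ⟨M, hM2, hd₀M, hlt⟩ := window_arith b d₀ hδ hε
  obtain ⟨m, rfl⟩ : ∃ m, M = m + 1 := ⟨M - 1, by omega⟩
  have hchar : ∀ i : ℕ, 0 < i → i ≤ dd (m + 1) → (i : ℂ) ≠ 0 := fun i hi _ => by
    exact_mod_cast hi.ne'
  have hlow : ((m + 1 : ℕ) : ℝ) ^ (((dd (m + 1) : ℕ) : ℝ) ^ δ) ≤ (s (t m) : ℝ) :=
    hL ℂ (m + 1) (dd (m + 1)) hd₀M hchar (hdd_log (m + 1)) (s (t m)) (key m)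
  have hup : (s (t m) : ℝ) ≤ (((m + 1) ^ b + b : ℕ) : ℝ) := by
    have h1 : s (t m) ≤ m ^ b + b := hb m
    have h2 : m ^ b + b ≤ (m + 1) ^ b + b :=
      Nat.add_le_add_right (Nat.pow_le_pow_left (Nat.le_succ m) b) b
    exact_mod_cast h1.trans h2
  exact absurd (hlow.trans hup) (not_le.2 hlt)

/-! ### The route item -/

/-- **S-case of rung R2 (PROVED): for every constant top fan-in `k₀`, `(per_n)` is NOT in the
Dutta–Dwivedi–Saxena ε-border of `Σ^[k₀]Π^[d]Σ` with p-bounded `d`** — the route item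
`PerNotInBorderConstFaninEps`, by `perPoly_not_mem_borderClass_constDepth` at product-depth `1` and the
change of currency `mem_borderClass_of_mem_border_spsClass`.
[cite: AndrewsForbes2022, Cor. 6.5; DuttaDwivediSaxena2022, Def. 2.1] -/
theorem perNotInBorderConstFaninEps_holds : PerNotInBorderConstFaninEps := by
  intro k₀
  rintro ⟨d, hd, hmem⟩
  refine perPoly_not_mem_borderClass_constDepth 1
    ⟨fun n => k₀ * (d n * (n * n + 2) + 1), ?_, fun n => ?_⟩
  · exact IsPBounded.mul_holds (IsPBounded.const k₀) (IsPBounded.add_holds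
      (IsPBounded.mul_holds hd (IsPBounded.add_holds (IsPBounded.mul_holds IsPBounded.id
        IsPBounded.id) (IsPBounded.const 2))) (IsPBounded.const 1))
  · have h1 := mem_borderClass_of_mem_border_spsClass (hmem n)
    have h2 := rename_mem_borderClass_productDepthEdgeClass h1 (finProdFinEquiv (m := n) (n := n)).symm
    rwa [rename_rename, Equiv.symm_comp_self, rename_id_apply] at h2

end Summit.ValiantsHypothesis.ValiantsHypothesis.Theorems.DecompCycle1CPerBorderConstDepth

end
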